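import Summits.KontsevichZagierPeriods.KontsevichZagierPeriods.Theorems.UnfoldedStokesStokesGenerationFibrewiseRungDimOneRational
import Summits.KontsevichZagierPeriods.KontsevichZagierPeriods.Theorems.UnfoldedStokesStokesGenerationStubRungCertificate
import Summits.KontsevichZagierPeriods.KontsevichZagierPeriods.Theorems.UnfoldedStokesStokesGenerationStubRungInhomBaker
import Summits.KontsevichZagierPeriods.KontsevichZagierPeriods.Theorems.UnfoldedStokesStokesGenerationStubRungExactElement
import Summits.KontsevichZagierPeriods.KontsevichZagierPeriods.Theorems.InverseLandauTateLiftingBakerDecomposition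
import Summits.KontsevichZagierPeriods.KontsevichZagierPeriods.Theorems.UnfoldedStokesStokesGenerationStubSaDlogProd
import Summits.KontsevichZagierPeriods.KontsevichZagierPeriods.Theorems.UnfoldedStokesStokesGenerationStubSaDlogValue
import Summits.KontsevichZagierPeriods.KontsevichZagierPeriods.Theorems.UnfoldedStokesStokesGenerationFibrewiseRungTransport

/-!
# `StokesGeneration` (stmt-KontsevichZagierPeriods-3586), line `fibrewise_stokes` — rung 10a: the semialgebraic dlog sector

Crux `Summit.KontsevichZagierPeriods.KontsevichZagierPeriods.Theses.UnfoldedStokes.StokesGeneration`; residual S2 =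
`FibrewiseStokesGenerationConjecture`. Rung 10 (lead c5) generalises the dimension-one Baker layer of S2 from POLYNOMIAL to
SEMIALGEBRAIC data — logarithmic differentials `dG₀ + Σ cᵢ dlog fᵢ (+ Σ dₖ d arg(Aₖ + iBₖ))` with `ℚ`-semialgebraic `C¹` functions,
i.e. everything below genus one. This file is the dlog half (`fibStokesDecomposable_saDlogSector`): a closed-interval representation
with integrand `g₀ + Σᵢ cᵢ fᵢ′/fᵢ` (`fᵢ` POSITIVE semialgebraic `C¹` units on `[0,1]`, e.g. `x + √(x² + 1)`; `cᵢ` algebraic) and value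
`0` is fibrewise-Stokes decomposable — rung 2's assembly verbatim: the endpoint ratios `fᵢ(1)/fᵢ(0)` are algebraic (values of
semialgebraic functions at algebraic points), the value formula (`stub_saDlogValue`, p132241), inhomogeneous Baker
(`stub_rungInhomBaker`), Baker's decomposition into integer multiplicative relations (`tateLifting_bakerDecomposition`), the
semialgebraic normalised product (`stub_saDlogProd`, p132297) fed to the landed two-element certificate `stub_rungCertificate`
(differential-algebraic, never needed polynomials), and one exact element (`stub_rungExactElement`).

References: M. Kontsevich, D. Zagier, *Periods* (2001), §1.1–1.2; J. Ayoub, Ann. of Math. 181 (2015), Conj. 1.1, Rem. 1.5;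
A. Baker, *Transcendental Number Theory* (1975), Ch. 2, Thm. 2.1.
-/

noncomputable section

set_option linter.dupNamespace false

namespace Summit.KontsevichZagierPeriods.KontsevichZagierPeriods.Cruxes.StokesGeneration.FibrewiseStokes

open MeasureTheory Set
open Literature.NumberTheory.Transcendental
open Literature.NumberTheory.Transcendental.KZ
open Literature.ModelTheory.ExponentialFields (IsSemialgebraic)

/-! ## Rung 10a: the semialgebraic dlog sector -/

/-- **S2 on the semialgebraic dlog sector with an exact part (rung 10a; lead c5).** A closed-interval representation with
integrand `g₀ + Σᵢ cᵢ fᵢ′/fᵢ` — `G₀′ = g₀` the exact part, `fᵢ` POSITIVE `ℚ`-SEMIALGEBRAIC `C¹` FUNCTIONS on `[0,1]` (not only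
polynomials: logarithmic differentials of semialgebraic units, e.g. `d log(x + √(x² + 1))`), `cᵢ` real algebraic — and value `0`
is fibrewise-Stokes decomposable: the endpoint ratios `fᵢ(1)/fᵢ(0)` are algebraic (`IsSemialgebraicFunOn.isAlgebraic_apply`), the
value is `(G₀(1) − G₀(0)) + Σ cᵢ log(fᵢ(1)/fᵢ(0))` (`stub_saDlogValue`), inhomogeneous Baker kills the constant, Baker's
decomposition gives integer multiplicative relations, each normalised product `Π (fᵢ/fᵢ(0))^{Mᵢ}` (`stub_saDlogProd`) is fed to the
landed two-element certificate `stub_rungCertificate` (which is differential-algebraic and never needed polynomials), plus one exact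
element. [cite: Baker1975, Thm 2.1] -/
theorem fibStokesDecomposable_saDlogSector (s : ℕ) (f f' : Fin s → ℝ → ℝ) (c : Fin s → ℝ) (G₀ g₀ : ℝ → ℝ)
    (hf : ∀ i, IsSemialgebraicFunOn ℚ (Set.pi Set.univ (fun _ : Fin 1 => Set.Icc (0:ℝ) 1)) (fun z => f i (z 0)))
    (hf' : ∀ i, IsSemialgebraicFunOn ℚ (Set.pi Set.univ (fun _ : Fin 1 => Set.Icc (0:ℝ) 1)) (fun z => f' i (z 0)))
    (hc : ∀ i, IsAlgebraic ℚ (c i)) (hpos : ∀ i, ∀ u ∈ Set.Icc (0:ℝ) 1, 0 < f i u)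
    (hfc : ∀ i, ContinuousOn (f i) (Set.Icc (0:ℝ) 1)) (hf'c : ∀ i, ContinuousOn (f' i) (Set.Icc (0:ℝ) 1))
    (hfd : ∀ i, ∀ u ∈ Set.Ioo (0:ℝ) 1, HasDerivAt (f i) (f' i u) u)
    (hG₀ : IsSemialgebraicFunOn ℚ (Set.pi Set.univ (fun _ : Fin 1 => Set.Icc (0:ℝ) 1)) (fun z => G₀ (z 0)))
    (hg₀ : IsSemialgebraicFunOn ℚ (Set.pi Set.univ (fun _ : Fin 1 => Set.Icc (0:ℝ) 1)) (fun z => g₀ (z 0)))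
    (hder : ∀ u ∈ Set.Icc (0:ℝ) 1, HasDerivAt G₀ (g₀ u) u) (hg₀c : ContinuousOn g₀ (Set.Icc (0:ℝ) 1))
    (t : IntegralRep 1) (ht : t.domain = Set.pi Set.univ (fun _ : Fin 1 => Set.Icc (0:ℝ) 1))
    (hti : ∀ z ∈ Set.pi Set.univ (fun _ : Fin 1 => Set.Icc (0:ℝ) 1), t.integrand z =
      g₀ (z 0) + ∑ i, c i * (f' i (z 0) / f i (z 0)))
    (hval : t.value = 0) : FibStokesDecomposable 1 t.integrand := by
  classical
  classical
  -- positivity / algebraicity of `αᵢ = pᵢ(1)/pᵢ(0)`; algebraicity of `G₀(1) − G₀(0)`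
  have h0 : (0:ℝ) ∈ Set.Icc (0:ℝ) 1 := ⟨le_rfl, zero_le_one⟩
  have h1 : (1:ℝ) ∈ Set.Icc (0:ℝ) 1 := ⟨zero_le_one, le_rfl⟩
  have hβ : IsAlgebraic ℚ (G₀ 1 - G₀ 0) := by
    have e1 := hG₀.isAlgebraic_apply (a := fun _ => (1:ℝ)) (fun _ _ => h1) fun _ => isAlgebraic_one
    have e0 := hG₀.isAlgebraic_apply (a := fun _ => (0:ℝ)) (fun _ _ => h0) fun _ => isAlgebraic_zero
    exact mem_algebraicClosure_iff.mp
      (sub_mem (mem_algebraicClosure_iff.mpr e1) (mem_algebraicClosure_iff.mpr e0))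
  have hαpos : ∀ i, 0 < f i 1 / f i 0 := fun i => div_pos (hpos i 1 h1) (hpos i 0 h0)
  have hαalg : ∀ i, IsAlgebraic ℚ (f i 1 / f i 0) := fun i => by
    have e1 := (hf i).isAlgebraic_apply (a := fun _ => (1:ℝ)) (fun _ _ => h1) fun _ => isAlgebraic_one
    have e0 := (hf i).isAlgebraic_apply (a := fun _ => (0:ℝ)) (fun _ _ => h0) fun _ => isAlgebraic_zero
    exact mem_algebraicClosure_iff.mp
      (div_mem (mem_algebraicClosure_iff.mpr e1) (mem_algebraicClosure_iff.mpr e0))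
  -- the value, and the inhomogeneous Baker step
  have hv := stub_saDlogValue s f f' c G₀ g₀ hpos hfc hf'c hfd hder hg₀c t ht hti
  rw [hval] at hv
  have hβ0 : G₀ 1 - G₀ 0 = 0 :=
    stub_rungInhomBaker s (fun i => f i 1 / f i 0) c (G₀ 1 - G₀ 0) hαpos hαalg hc hβ hv.symm
  have hsum : ∑ i, c i * Real.log (f i 1 / f i 0) = 0 := by
    rw [hβ0, zero_add] at hv; exact hv.symm
  -- Baker's decomposition of `c`
  obtain ⟨tq, Mq, γ, hγ, hMq, hcM⟩ :=
    Summit.KontsevichZagierPeriods.InverseLandau.tateLifting_bakerDecomposition s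
      (fun i => f i 1 / f i 0) c hαpos hαalg hc hsum
  -- normalised products and the two-element certificates
  set P : Fin tq → ℝ → ℝ := fun q u => ∏ i, (f i u / f i 0) ^ (Mq q i) with hP
  set P' : Fin tq → ℝ → ℝ := fun q u =>
    P q u * ∑ i, (Mq q i : ℝ) * (f' i u / f i u) with hP'
  have hR5 := fun q => stub_saDlogProd s f f' (Mq q) (P q) (P' q) hf hf' hpos hfc hf'c hfd (hMq q)
    (fun u => rfl) (fun u => rfl)
  have hR2 : ∀ q, ∃ (G D : Fin 2 → (Fin 2 → ℝ) → ℝ) (r : Fin 2 → IntegralRep 2),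
      (∀ j, IsSemialgebraicFunOn ℚ (Set.pi Set.univ (fun _ : Fin 2 => Set.Icc (0:ℝ) 1)) (G j) ∧
        IsSemialgebraicFunOn ℚ (Set.pi Set.univ (fun _ : Fin 2 => Set.Icc (0:ℝ) 1)) (D j) ∧
        (∃ B : ℝ, ∀ x ∈ Set.pi Set.univ (fun _ : Fin 2 => Set.Icc (0:ℝ) 1), |(G j) x| ≤ B) ∧
        (∀ x ∈ Set.pi Set.univ (fun _ : Fin 2 => Set.Icc (0:ℝ) 1),
          ContinuousOn (fun s : ℝ => (G j) (Function.update x j s)) (Set.Icc (0:ℝ) 1)) ∧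
        (∀ x ∈ Set.pi Set.univ (fun _ : Fin 2 => Set.Icc (0:ℝ) 1), x j ∈ Set.Ioo (0:ℝ) 1 →
          HasDerivAt (fun s : ℝ => (G j) (Function.update x j s)) ((D j) x) (x j))) ∧
      (∀ j, (r j).domain = Set.pi Set.univ (fun _ : Fin 2 => Set.Icc (0:ℝ) 1) ∧
        ∀ x ∈ Set.pi Set.univ (fun _ : Fin 2 => Set.Icc (0:ℝ) 1), (r j).integrand x =
          D j x - (G j (Function.update x j 1) - G j (Function.update x j 0))) ∧
      ∀ x ∈ Set.pi Set.univ (fun _ : Fin 2 => Set.Icc (0:ℝ) 1),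
        γ q * (P' q (x 0) / P q (x 0)) = ∑ j, (r j).integrand x := fun q =>
    stub_rungCertificate (γ q) (P q) (P' q) (hγ q) (hR5 q).1 (hR5 q).2.1 (hR5 q).2.2.1
      (hR5 q).2.2.2.1 (hR5 q).2.2.2.2.1 (hR5 q).2.2.2.2.2.1 (hR5 q).2.2.2.2.2.2.1
      (hR5 q).2.2.2.2.2.2.2.1
  choose G D r hGD hr hid using hR2
  -- the exact element
  obtain ⟨Ge, De, qe, hGe, hqe, hide⟩ := stub_rungExactElement G₀ g₀ (isSemialgebraicFunOn_sq_of_interval hG₀)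
    (isSemialgebraicFunOn_sq_of_interval hg₀)
    (HasDerivAt.continuousOn fun u hu => hder u hu) hg₀c (fun u hu => hder u (Set.Ioo_subset_Icc_self hu))
  -- concatenate: `2 · tq` certificate elements, then the exact element last
  set e : Fin tq × Fin 2 ≃ Fin (tq * 2) := finProdFinEquiv with he
  refine ⟨2, by norm_num, tq * 2 + 1,
    Fin.snoc (fun j => (e.symm j).2) 0,
    Fin.snoc (fun j => G (e.symm j).1 (e.symm j).2) Ge,
    Fin.snoc (fun j => D (e.symm j).1 (e.symm j).2) De,
    fun _ => ∅,
    Fin.snoc (fun j => r (e.symm j).1 (e.symm j).2) qe, ∅,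
    fun j => ?_, fun j => ?_,
    Literature.ModelTheory.ExponentialFields.isSemialgebraic_empty, measure_empty, ?_⟩
  · refine Fin.lastCases ?_ (fun j => ?_) j
    · simp only [Fin.snoc_last]
      obtain ⟨h1, h2, h3, h4, h5⟩ := hGe
      exact ⟨h1, h2, Literature.ModelTheory.ExponentialFields.isSemialgebraic_empty, h3,
        fun x _ => by simp, h4, fun x hx _ hxj => h5 x hx hxj⟩
    · simp only [Fin.snoc_castSucc]
      obtain ⟨h1, h2, h3, h4, h5⟩ := hGD (e.symm j).1 (e.symm j).2
      exact ⟨h1, h2, Literature.ModelTheory.ExponentialFields.isSemialgebraic_empty, h3,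
        fun x _ => by simp, h4, fun x hx _ hxj => h5 x hx hxj⟩
  · refine Fin.lastCases ?_ (fun j => ?_) j
    · simp only [Fin.snoc_last]; exact hqe
    · simp only [Fin.snoc_castSucc]; exact hr (e.symm j).1 (e.symm j).2
  · intro x hx _
    have hx0 : x 0 ∈ Set.Icc (0:ℝ) 1 := hx 0 (Set.mem_univ _)
    have hx1 : (fun l : Fin 1 => x (Fin.castLE (by norm_num : 1 ≤ 2) l)) ∈
        Set.pi Set.univ (fun _ : Fin 1 => Set.Icc (0:ℝ) 1) := fun l _ => hx _ (Set.mem_univ _)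
    rw [hti _ hx1]
    have hcast : x (Fin.castLE (by norm_num : 1 ≤ 2) 0) = x 0 := rfl
    simp only [hcast]
    rw [Fin.sum_univ_castSucc]
    simp only [Fin.snoc_castSucc, Fin.snoc_last]
    -- the certificate block
    have hrhs : ∑ j : Fin (tq * 2), (r (e.symm j).1 (e.symm j).2).integrand x =
        ∑ q, γ q * ∑ i, (Mq q i : ℝ) * (f' i (x 0) / f i (x 0)) := by
      rw [e.symm.sum_comp (fun pr : Fin tq × Fin 2 => (r pr.1 pr.2).integrand x), Fintype.sum_prod_type]
      refine Finset.sum_congr rfl fun q _ => ?_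
      rw [← hid q x hx, (hR5 q).2.2.2.2.2.2.2.2 (x 0) hx0]
    rw [hrhs, hide x hx, hβ0, sub_zero, add_comm]
    congr 1
    calc ∑ i, c i * (f' i (x 0) / f i (x 0))
        = ∑ i, (∑ q, γ q * (Mq q i : ℝ)) * (f' i (x 0) / f i (x 0)) := by simp only [← hcM]
      _ = ∑ i, ∑ q, γ q * ((Mq q i : ℝ) * (f' i (x 0) / f i (x 0))) := by
          simp only [Finset.sum_mul, mul_assoc]
      _ = ∑ q, γ q * ∑ i, (Mq q i : ℝ) * (f' i (x 0) / f i (x 0)) := by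
          rw [Finset.sum_comm]; simp only [Finset.mul_sum]


end Summit.KontsevichZagierPeriods.KontsevichZagierPeriods.Cruxes.StokesGeneration.FibrewiseStokes

end
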